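import Summits.QuantumFields.YangMills.Theorems.FlatTubeReductionKernelParity
import HarnessLib

/-!
# Kernel parity at the level of EXPONENTS: `K₂ = K₁·exp(A + R)` with `A` odd ⇒ `|K₂ − K₁(1 + A)| ≤ (ρ + (a+ρ)²)·K₁`, and the diagonal comparison pays only second order
# (route `FlatTubeReduction`, crux K1 `NearFlatRatioLaw` stmt-QuantumFields-24720, registered stub `stub_boRate` = FCL 23943's `BORateAll`; line «borate»;
# rung R2b1 = RECORD-label femto gap; no summit statement is proved here)

Seat `ym-line-ftr-p1` g7 (prover).  Transfer kernels are exponentials of actions: in chart coordinates the true kernel reads `K₂ = K₁·exp(A + R)` where `K₁` is the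
c-frozen fibred model, `A` collects the terms of the action expansion that are ODD under the fibre reflection `ι` (cubic part of the step action — the transported
step to second order, `Cruxes/NearFlatRatioLaw/Lines/borate-rate-uniformity-g7.md` (O5); anharmonic cubic (O1); Coriolis (O2)), of size `|A| ≤ a ≍ β^{-1/2}·polylog`,
and `R` the EVEN remainder `|R| ≤ ρ = O(β^{-1}·polylog)` (quartic remainders, Laplace corrections).  This file turns that exponent-level information into the
kernel-level hypothesis of g6's `KernelParity.abs_form_sub_le_of_kernel_near_odd` (p632175):
* `abs_exp_sub_one_sub_le_sq` — `|a + r| ≤ 1 ⇒ |exp(a + r) − 1 − a| ≤ |r| + (a + r)²` (Mathlib's `Real.abs_exp_sub_one_sub_id_le`);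
* ★ `kernel_near_odd_of_exp` — `0 ≤ K₁`, `K₂ = K₁ exp(A + R)`, `|A| ≤ a`, `|R| ≤ ρ`, `a + ρ ≤ 1` ⇒ `|K₂ − K₁(1 + A)| ≤ (ρ + (a + ρ)²)·K₁` pointwise;
* ★★ `abs_form_sub_le_of_exp_near_odd` — hence, for `K₁` symmetric `ι`-even with rows `≤ M₁`, `A` `ι`-odd and `f` `ι`-even:
  `|⟨f,K₂f⟩ − ⟨f,K₁f⟩| ≤ (ρ + (a+ρ)²)·M₁·‖f‖²` — the first-order size `a` enters only SQUARED (`a² ≍ β^{-1}·polylog² = O(λ_b(L³β)³)`), never linearly.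
HONEST FRAMING: elementary real analysis for the registered stub of a crux of the CONDITIONAL reduction route to the femto rung R2b1 (RECORD label); the chart supplying
`K₁, A, R, ι` is OPEN (route RED lane A C4-CORE (d) + the rate twin); nothing here is infinite volume, a continuum limit or the Clay mass gap.  No definitions, no `sorry`.

## References
* B. Helffer, *Spectral Theory and its Applications*, CUP 2013, Lemma 7.1 (Schur's test) — [cite: Helffer2013, Lemma 7.1 pp.77–78].
* M. Lüscher, Nucl. Phys. B219 (1983) 233, §3 (parity of the cubic vertex in the constant-mode expansion) — [cite: Luscher1983, §3].
-/

set_option autoImplicit false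

noncomputable section

open MeasureTheory

namespace Summit.QuantumFields.YangMills.Theorems.FemtoTransferGap.KernelParity

/-- `|a + r| ≤ 1 ⇒ |exp(a + r) − 1 − a| ≤ |r| + (a + r)²`: the exponential of a small odd-plus-even exponent is `1 + (odd) + O(|even| + (total)²)`. [folklore] -/
theorem abs_exp_sub_one_sub_le_sq {a r : ℝ} (h : |a + r| ≤ 1) :
    |Real.exp (a + r) - 1 - a| ≤ |r| + (a + r) ^ 2 := by
  have h1 := Real.abs_exp_sub_one_sub_id_le h
  have e : Real.exp (a + r) - 1 - a = (Real.exp (a + r) - 1 - (a + r)) + r := by ring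
  rw [e]
  exact (abs_add_le _ _).trans (by linarith)

/-- ★ **From exponents to kernels**: if `0 ≤ K₁`, `K₂ = K₁·exp(A + R)` pointwise with `|A| ≤ a`, `|R| ≤ ρ` and `a + ρ ≤ 1`, then
`|K₂ − K₁(1 + A)| ≤ (ρ + (a + ρ)²)·K₁` pointwise — the hypothesis `hnear` of `abs_form_sub_le_of_kernel_near_odd` with the SECOND-order size
`η = ρ + (a + ρ)²`. [folklore] -/
theorem kernel_near_odd_of_exp {X : Type*} {K₁ K₂ A R : X → X → ℝ} {a ρ : ℝ} (hK₁ : ∀ x y, 0 ≤ K₁ x y)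
    (hK₂ : ∀ x y, K₂ x y = K₁ x y * Real.exp (A x y + R x y)) (hA : ∀ x y, |A x y| ≤ a) (hR : ∀ x y, |R x y| ≤ ρ) (h1 : a + ρ ≤ 1) :
    ∀ x y, |K₂ x y - K₁ x y * (1 + A x y)| ≤ (ρ + (a + ρ) ^ 2) * K₁ x y := by
  intro x y
  have ha0 : 0 ≤ a := (abs_nonneg _).trans (hA x y)
  have hρ0 : 0 ≤ ρ := (abs_nonneg _).trans (hR x y)
  have hsum : |A x y + R x y| ≤ a + ρ := (abs_add_le _ _).trans (add_le_add (hA x y) (hR x y))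
  have hexp : |Real.exp (A x y + R x y) - 1 - A x y| ≤ ρ + (a + ρ) ^ 2 := by
    refine (abs_exp_sub_one_sub_le_sq (hsum.trans h1)).trans (add_le_add (hR x y) ?_)
    have := abs_le.mp hsum
    nlinarith [this.1, this.2]
  have e : K₂ x y - K₁ x y * (1 + A x y) = K₁ x y * (Real.exp (A x y + R x y) - 1 - A x y) := by rw [hK₂]; ring
  rw [e, abs_mul, abs_of_nonneg (hK₁ x y), mul_comm]
  exact mul_le_mul_of_nonneg_right hexp (hK₁ x y)

variable {X : Type*} [MeasurableSpace X] {μ : Measure X} [SFinite μ]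

/-- ★★ **DIAGONAL comparison from an exponent expansion with ODD first order.**  `K₁ ≥ 0` symmetric, `ι`-even, rows `≤ M₁`; `K₂ = K₁·exp(A + R)` with `A` `ι`-odd,
`|A| ≤ a`, `|R| ≤ ρ` (`0 ≤ ρ`), `a + ρ ≤ 1`; `f` `ι`-even (with the product-integrability side conditions of `abs_form_sub_le_of_kernel_near_odd`).  Then
`|⟨f,K₂f⟩ − ⟨f,K₁f⟩| ≤ (ρ + (a + ρ)²)·M₁·‖f‖²`: the odd first-order size `a` (for the rate twin `≍ β^{-1/2}·polylog ≫ λ_b²`) is paid only squared.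
[cite: Helffer2013, Lemma 7.1 pp.77–78] [cite: Luscher1983, §3] -/
theorem abs_form_sub_le_of_exp_near_odd (ι : X ≃ᵐ X) (hι : MeasurePreserving ι μ μ)
    {K₁ K₂ A R : X → X → ℝ} {a ρ M₁ : ℝ} (hK₁ : ∀ x y, 0 ≤ K₁ x y)
    (hsymm : ∀ x y, K₁ x y = K₁ y x) (hrow : ∀ᵐ x ∂μ, ∫ y, K₁ x y ∂μ ≤ M₁)
    (hK₁ι : ∀ x y, K₁ (ι x) (ι y) = K₁ x y) (hAι : ∀ x y, A (ι x) (ι y) = -A x y)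
    (hK₂ : ∀ x y, K₂ x y = K₁ x y * Real.exp (A x y + R x y)) (hA : ∀ x y, |A x y| ≤ a) (hR : ∀ x y, |R x y| ≤ ρ) (hρ : 0 ≤ ρ) (h1 : a + ρ ≤ 1)
    {f : X → ℝ} (hfι : ∀ x, f (ι x) = f x) (hf : Integrable (fun x => f x ^ 2) μ)
    (hI2 : Integrable (fun p : X × X => f p.1 * K₂ p.1 p.2 * f p.2) (μ.prod μ))
    (hIA : Integrable (fun p : X × X => f p.1 * (K₁ p.1 p.2 * A p.1 p.2) * f p.2) (μ.prod μ))
    (hI : Integrable (fun p : X × X => |f p.1| * K₁ p.1 p.2 * |f p.2|) (μ.prod μ))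
    (hIs : Integrable (fun p : X × X => f p.1 * K₁ p.1 p.2 * f p.2) (μ.prod μ))
    (hI₁ : Integrable (fun p : X × X => K₁ p.1 p.2 * f p.1 ^ 2) (μ.prod μ))
    (hI₂ : Integrable (fun p : X × X => K₁ p.1 p.2 * f p.2 ^ 2) (μ.prod μ)) :
    |(∫ x, ∫ y, f x * K₂ x y * f y ∂μ ∂μ) - ∫ x, ∫ y, f x * K₁ x y * f y ∂μ ∂μ| ≤ (ρ + (a + ρ) ^ 2) * M₁ * ∫ x, f x ^ 2 ∂μ := by
  have hη : 0 ≤ ρ + (a + ρ) ^ 2 := by positivity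
  exact abs_form_sub_le_of_kernel_near_odd ι hι hη hK₁ hsymm hrow hK₁ι hAι (kernel_near_odd_of_exp hK₁ hK₂ hA hR h1) hfι hf hI2 hIA hI hIs hI₁ hI₂

end Summit.QuantumFields.YangMills.Theorems.FemtoTransferGap.KernelParity

end
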